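import Literature.NumberTheory.LFunctions.RiemannXiLogDeriv
import Literature.Analysis.SpecialFunctions.GammaRatioStirling
import Mathlib.NumberTheory.ZetaValues
import Mathlib.Analysis.Calculus.MeanValue
import HarnessLib

/-!
# `ξ'/ξ` on horizontal rays at large height: `ξ'/ξ(v + iT) ≈ ½ log(T/2π) + iπ/4`

Trunk T-ANT (`Literature/NumberTheory/LFunctions`). Everything here is proved (no named facts).
Second file of the in-tree proof of `Literature.NumberTheory.LFunctions.ki_kim_lee_finite` (Ki–Kim–Lee 2009, Thm. 1.3; see
`DeBruijnHXiHeatRay.lean` for the reduction). The saddle-point analysis of the Gaussian ray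
transform `𝒜_t(s) = ∫_0^∞ e^{-u²/t} ξ(s+u) du` (Ki–Kim–Lee 2009, §4; Polymath 15, §9) rests on
the behaviour of `ξ` along the horizontal ray `v ↦ ξ(v + iT)`, `v ≥ 5`, at large height `T`:
there `ξ'/ξ(v + iT) = 1/w + 1/(w−1) − ½ log π + ½ ψ(w/2) − Σ Λ(n) n^{-w}` (`w = v + iT`), and
Stirling's formula for `ψ` in the first quadrant (`Literature.Analysis.SpecialFunctions.Complex.norm_digamma_sub_log_le`,
`GammaRatioStirling.lean`) gives the **model value** `κ_T = ½ log(T/2π) + iπ/4`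
(`Literature.NumberTheory.LFunctions.xiLogDerivModel`) up to `O(1/T + v/T)` and the prime sum `Σ_{n ≥ 2} Λ(n) n^{-5} < 0.083`.
Integrating `ξ'/ξ` along the ray (`ξ ≠ 0` for `Re ≥ 1`) yields the two-point control
`ξ(v₀ + a + iT) = ξ(v₀ + iT) e^{κ_T a + ρ}`, `|ρ| ≤ a (η_T + (v₀ + a)/(2T))`, which is the input of
Laplace's method in `XiHeatRayLaplace.lean`.

## Main results

* `Literature.NumberTheory.LFunctions.norm_LSeries_vonMangoldt_le_of_five_le_re` — `‖Σ Λ(n) n^{-s}‖ ≤ π⁴/90 − 1` for `Re s ≥ 5`.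
* `Literature.xiLogDerivModel T = ½ log(T/2π) + iπ/4`.
* `Literature.NumberTheory.LFunctions.norm_logDeriv_riemannXi_sub_model_le` — for `T ≥ 5`, `v ≥ 5`:
  `‖ξ'/ξ(v + iT) − κ_T‖ ≤ (π⁴/90 − 1) + 4/T + v/(2T)`.
* `Literature.NumberTheory.LFunctions.riemannXi_eq_mul_exp_integral_logDeriv` — `ξ(w₀ + a) = ξ(w₀) exp(∫_0^a ξ'/ξ(w₀ + x) dx)`
  for `Re w₀ ≥ 1`, `a ≥ 0`.
* `Literature.NumberTheory.LFunctions.riemannXi_horizontal_two_point` — the two-point control above, and its consequences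
  `Literature.NumberTheory.LFunctions.norm_riemannXi_horizontal_le` / `Literature.NumberTheory.LFunctions.le_norm_riemannXi_horizontal` for `|ξ|`.

## References

* H. Ki, Y.-O. Kim, J. Lee, *On the de Bruijn–Newman constant*, Adv. Math. 222 (2009), §4.
* D. H. J. Polymath, *Effective approximation of heat flow evolution of the Riemann ξ function…*,
  Res. Math. Sci. 6 (2019) 31, §9.
* E. C. Titchmarsh, *The Theory of the Riemann Zeta-Function*, 2nd ed., §2.12, §4.12.
-/

noncomputable section

open Complex Filter Topology Set MeasureTheory intervalIntegral LSeries
open scoped Real LSeries.notation ArithmeticFunction.vonMangoldt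

namespace Literature.NumberTheory.LFunctions

/-! ## The prime sum `Σ Λ(n) n^{-s}` on `Re s ≥ 5` -/

/-- **`‖Σ Λ(n) n^{-s}‖ ≤ ζ(4) − 1 = π⁴/90 − 1` for `Re s ≥ 5`** (`Λ(n) ≤ log n < n`, so
`Λ(n) n^{-5} ≤ n^{-4}` for `n ≥ 2`, and `Λ(1) = 0`). [folklore] -/
theorem norm_LSeries_vonMangoldt_le_of_five_le_re {s : ℂ} (hs : 5 ≤ s.re) :
    ‖L ↗Λ s‖ ≤ π ^ 4 / 90 - 1 := by
  have hs1 : 1 < s.re := by linarith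
  have hsum : Summable fun n ↦ ‖term ↗Λ s n‖ :=
    (ArithmeticFunction.LSeriesSummable_vonMangoldt hs1).norm
  set h : ℕ → ℝ := fun n ↦ if n = 1 then 0 else 1 / (n : ℝ) ^ 4 with hh
  have hh_sum : HasSum h (π ^ 4 / 90 - 1) := by
    have h1 := hasSum_zeta_four
    have h2 : HasSum (fun n : ℕ ↦ if n = 1 then (1 : ℝ) else 0) 1 := hasSum_ite_eq 1 1
    have heq : h = fun n : ℕ ↦ 1 / (n : ℝ) ^ 4 - (if n = 1 then (1 : ℝ) else 0) := by
      funext n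
      simp only [hh]
      split_ifs with hn
      · subst hn; norm_num
      · ring
    rw [heq]
    exact h1.sub h2
  have hle : ∀ n, ‖term ↗Λ s n‖ ≤ h n := by
    intro n
    rw [norm_term_eq]
    rcases eq_or_ne n 0 with rfl | hn0
    · simp [hh]
    rw [if_neg hn0]
    simp only [hh]
    rcases eq_or_ne n 1 with rfl | hn1
    · simp [ArithmeticFunction.vonMangoldt_apply_one]
    rw [if_neg hn1]
    have hn2 : 2 ≤ n := by omega
    have hn2' : (2 : ℝ) ≤ n := by exact_mod_cast hn2
    have hΛ : ‖((Λ n : ℝ) : ℂ)‖ ≤ (n : ℝ) := by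
      rw [Complex.norm_real, Real.norm_eq_abs, abs_of_nonneg ArithmeticFunction.vonMangoldt_nonneg]
      have h1 : Λ n ≤ Real.log n := ArithmeticFunction.vonMangoldt_le_log
      have h2 : Real.log n ≤ (n : ℝ) - 1 := Real.log_le_sub_one_of_pos (by linarith)
      linarith
    have hpow : (n : ℝ) ^ 5 ≤ (n : ℝ) ^ s.re := by
      calc (n : ℝ) ^ 5 = (n : ℝ) ^ ((5 : ℕ) : ℝ) := (Real.rpow_natCast _ 5).symm
        _ ≤ (n : ℝ) ^ s.re :=
            Real.rpow_le_rpow_of_exponent_le (by linarith) (by exact_mod_cast hs)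
    have hn0' : (0 : ℝ) < n := by linarith
    calc ‖((Λ n : ℝ) : ℂ)‖ / (n : ℝ) ^ s.re ≤ (n : ℝ) / (n : ℝ) ^ 5 := by
          gcongr
        _ = 1 / (n : ℝ) ^ 4 := by field_simp
  calc ‖L ↗Λ s‖ = ‖∑' n, term ↗Λ s n‖ := rfl
    _ ≤ ∑' n, ‖term ↗Λ s n‖ := norm_tsum_le_tsum_norm hsum
    _ ≤ ∑' n, h n := hsum.tsum_le_tsum hle hh_sum.summable
    _ = π ^ 4 / 90 - 1 := hh_sum.tsum_eq

/-- Numerical value: `π⁴/90 − 1 ≤ 0.0824`. [folklore] -/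
theorem pi_pow_four_div_ninety_sub_one_le : π ^ 4 / 90 - 1 ≤ 0.0824 := by
  have hπ : π < 3.1416 := Real.pi_lt_d4
  have hπ0 : 0 < π := Real.pi_pos
  have h4 : π ^ 4 < 3.1416 ^ 4 := by gcongr
  norm_num at h4 ⊢
  linarith

/-! ## The model value `κ_T = ½ log(T/2π) + iπ/4` -/

/-- The model value of `ξ'/ξ` on the horizontal ray at height `T`:
`κ_T = ½ log(T/(2π)) + iπ/4` (the leading Stirling term of `½ψ(w/2) − ½ log π` at `w = iT`:
`½ Log(iT/2) − ½ log π`). [cite: Polymath2019, §9] -/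
def xiLogDerivModel (T : ℝ) : ℂ :=
  ((Real.log (T / (2 * π)) / 2 : ℝ) : ℂ) + ((π / 4 : ℝ) : ℂ) * I

/-- `Re κ_T = ½ log(T/2π)`. [folklore] -/
@[simp] theorem xiLogDerivModel_re (T : ℝ) : (xiLogDerivModel T).re = Real.log (T / (2 * π)) / 2 := by
  simp [xiLogDerivModel]

/-- `Im κ_T = π/4`. [folklore] -/
@[simp] theorem xiLogDerivModel_im (T : ℝ) : (xiLogDerivModel T).im = π / 4 := by
  simp [xiLogDerivModel]

/-- `Log((T/2) i) = log(T/2) + iπ/2` for `T > 0`. [folklore] -/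
theorem log_half_mul_I {T : ℝ} (hT : 0 < T) :
    Complex.log (((T / 2 : ℝ) : ℂ) * I) = ((Real.log (T / 2) : ℝ) : ℂ) + ((π / 2 : ℝ) : ℂ) * I := by
  apply Complex.ext
  · rw [Complex.log_re]
    simp [abs_of_pos hT]
  · rw [Complex.log_im, Complex.arg_real_mul I (half_pos hT), Complex.arg_I]
    simp

/-- `κ_T = ½ Log(iT/2) − ½ log π`. [folklore] -/
theorem xiLogDerivModel_eq {T : ℝ} (hT : 0 < T) :
    xiLogDerivModel T = 1 / 2 * Complex.log (((T / 2 : ℝ) : ℂ) * I) - ((Real.log π : ℝ) : ℂ) / 2 := by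
  rw [log_half_mul_I hT, xiLogDerivModel]
  have h : Real.log (T / (2 * π)) = Real.log (T / 2) - Real.log π := by
    rw [show T / (2 * π) = T / 2 / π by ring, Real.log_div (half_pos hT).ne' Real.pi_pos.ne']
  apply Complex.ext
  · simp [h]; ring
  · simp; ring

/-- **Horizontal mean-value bound for `Log`**: for `T > 0`, `v ≥ 0`,
`‖Log((v + iT)/2) − Log(iT/2)‖ ≤ v/T` (the derivative of `x ↦ Log((x+iT)/2)` is `1/(x+iT)`,
of norm `≤ 1/T`). [folklore] -/
theorem norm_log_sub_log_le_div {T : ℝ} (hT : 0 < T) {v : ℝ} (hv : 0 ≤ v) :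
    ‖Complex.log (((v : ℂ) + T * I) / 2) - Complex.log (((T / 2 : ℝ) : ℂ) * I)‖ ≤ v / T := by
  set f : ℝ → ℂ := fun x ↦ Complex.log (((x : ℂ) + T * I) / 2) with hf
  have hderiv : ∀ x : ℝ, HasDerivAt f (((x : ℂ) + T * I)⁻¹) x := by
    intro x
    have hz : ((x : ℂ) + T * I) / 2 ∈ slitPlane := by
      rw [Complex.mem_slitPlane_iff]; right
      simp [hT.ne']
    have hne : (x : ℂ) + T * I ≠ 0 := by
      intro h0; have := congrArg Complex.im h0; simp at this; exact hT.ne' this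
    have h1 : HasDerivAt (fun z : ℂ ↦ (z + T * I) / 2) (1 / 2) (x : ℂ) := by
      simpa using ((hasDerivAt_id (x : ℂ)).add_const (T * I)).div_const 2
    have h2 := (Complex.hasDerivAt_log hz).comp (x : ℂ) h1
    have h3 : (((x : ℂ) + T * I) / 2)⁻¹ * (1 / 2) = ((x : ℂ) + T * I)⁻¹ := by
      field_simp
    rw [h3] at h2
    exact h2.comp_ofReal
  have hbound : ∀ x ∈ Ico (0 : ℝ) v, ‖((x : ℂ) + T * I)⁻¹‖ ≤ 1 / T := by
    intro x _
    rw [norm_inv, ← one_div]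
    have : T ≤ ‖(x : ℂ) + T * I‖ := by
      have h := Complex.abs_im_le_norm ((x : ℂ) + T * I)
      simp only [add_im, ofReal_im, mul_im, ofReal_re, I_im, mul_one, I_re, mul_zero, add_zero,
        zero_add] at h
      rwa [abs_of_pos hT] at h
    exact one_div_le_one_div_of_le hT this
  have h := norm_image_sub_le_of_norm_deriv_le_segment'
    (fun x _ ↦ (hderiv x).hasDerivWithinAt) hbound v (right_mem_Icc.2 hv)
  have hf0 : f 0 = Complex.log (((T / 2 : ℝ) : ℂ) * I) := by
    simp only [hf]
    congr 1
    push_cast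
    ring
  have hfv : f v = Complex.log (((v : ℂ) + T * I) / 2) := rfl
  rw [hf0, hfv] at h
  calc _ ≤ 1 / T * (v - 0) := h
    _ = v / T := by ring

/-! ## `ξ'/ξ` against the model on the ray `Re w ≥ 5` -/

/-- **`ξ'/ξ` on horizontal rays at height `T`**: for `T ≥ 5` and `v ≥ 5`,
`‖ξ'/ξ(v + iT) − (½ log(T/2π) + iπ/4)‖ ≤ (π⁴/90 − 1) + 4/T + v/(2T)`.
From `ξ'/ξ(w) = 1/w + 1/(w−1) − ½ log π + ½ψ(w/2) − Σ Λ(n) n^{-w}`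
(`Literature.NumberTheory.LFunctions.logDeriv_riemannXi_eq_of_one_lt_re`), `‖ψ(u) − Log u‖ ≤ 1/(2‖u‖²) + π/(4 Im u) + Im u/‖u‖²`
in the first quadrant (`Literature.Analysis.SpecialFunctions.Complex.norm_digamma_sub_log_le`), `‖Log(w/2) − Log(iT/2)‖ ≤ v/T`
and `‖Σ Λ(n) n^{-w}‖ ≤ π⁴/90 − 1`. [cite: Titchmarsh1986, §4.12] -/
theorem norm_logDeriv_riemannXi_sub_model_le {T v : ℝ} (hT : 5 ≤ T) (hv : 5 ≤ v) :
    ‖logDeriv riemannXi ((v : ℂ) + T * I) - xiLogDerivModel T‖ ≤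
      (π ^ 4 / 90 - 1) + 4 / T + v / (2 * T) := by
  have hT0 : 0 < T := by linarith
  set w : ℂ := (v : ℂ) + T * I with hw
  have hwre : w.re = v := by simp [hw]
  have hwim : w.im = T := by simp [hw]
  have hre1 : 1 < w.re := by rw [hwre]; linarith
  have hre5 : 5 ≤ w.re := by rw [hwre]; exact hv
  rw [logDeriv_riemannXi_eq_of_one_lt_re hre1]
  -- `1/w`, `1/(w-1)`
  have hnorm_w : T ≤ ‖w‖ := by
    have := Complex.abs_im_le_norm w; rwa [hwim, abs_of_pos hT0] at this
  have h1 : ‖1 / w‖ ≤ 1 / T := by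
    rw [norm_div, norm_one]; exact one_div_le_one_div_of_le hT0 hnorm_w
  have h2 : ‖1 / (w - 1)‖ ≤ 1 / T := by
    rw [norm_div, norm_one]
    have : T ≤ ‖w - 1‖ := by
      have h := Complex.abs_im_le_norm (w - 1)
      rwa [sub_im, one_im, sub_zero, hwim, abs_of_pos hT0] at h
    exact one_div_le_one_div_of_le hT0 this
  -- digamma against `Log`
  set u : ℂ := w / 2 with hu
  have hure : u.re = v / 2 := by simp [hu, hw]
  have huim : u.im = T / 2 := by simp [hu, hw]
  have hure0 : 0 < u.re := by rw [hure]; linarith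
  have huim0 : 0 < u.im := by rw [huim]; linarith
  have hnorm_u : T / 2 ≤ ‖u‖ := by
    have := Complex.abs_im_le_norm u; rwa [huim, abs_of_pos (half_pos hT0)] at this
  have h3 : ‖digamma u - Complex.log u‖ ≤ 4 / T := by
    refine (Literature.Analysis.SpecialFunctions.Complex.norm_digamma_sub_log_le hure0 huim0).trans ?_
    rw [huim, abs_of_pos (half_pos hT0)]
    have hu2 : (T / 2) ^ 2 ≤ ‖u‖ ^ 2 := pow_le_pow_left₀ (by linarith) hnorm_u 2
    have hu0 : 0 < ‖u‖ ^ 2 := pow_pos (lt_of_lt_of_le (half_pos hT0) hnorm_u) 2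
    have hA : 1 / (2 * ‖u‖ ^ 2) ≤ 2 / T ^ 2 := by
      rw [div_le_div_iff₀ (mul_pos two_pos hu0) (by positivity)]; nlinarith
    have hB : π / (4 * (T / 2)) = π / (2 * T) := by ring
    have hC : T / 2 / ‖u‖ ^ 2 ≤ 2 / T := by
      rw [div_le_div_iff₀ hu0 hT0]; nlinarith
    have key : 2 / T ^ 2 + π / (2 * T) + 2 / T ≤ 4 / T := by
      have hT' : 2 / T ≤ 2 / 5 := div_le_div_of_nonneg_left (by norm_num) (by norm_num) hT
      have e : 2 / T ^ 2 + π / (2 * T) + 2 / T = (2 / T + π / 2 + 2) / T := by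
        field_simp
      rw [e, div_le_div_iff_of_pos_right hT0]
      linarith [Real.pi_lt_d2]
    rw [hB]
    linarith
  -- `Log(w/2)` against `Log(iT/2)`
  have h4 : ‖Complex.log u - Complex.log (((T / 2 : ℝ) : ℂ) * I)‖ ≤ v / T := by
    have := norm_log_sub_log_le_div hT0 (show (0 : ℝ) ≤ v by linarith)
    simpa [hu, hw] using this
  -- the prime sum
  have h5 : ‖L ↗Λ w‖ ≤ π ^ 4 / 90 - 1 := norm_LSeries_vonMangoldt_le_of_five_le_re hre5
  -- assemble
  have hmodel := xiLogDerivModel_eq hT0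
  have hsplit : 1 / w + 1 / (w - 1) + (-(Real.log π : ℂ) / 2 + 1 / 2 * digamma u) - L ↗Λ w -
      xiLogDerivModel T =
      1 / w + 1 / (w - 1) + 1 / 2 * (digamma u - Complex.log u) +
        1 / 2 * (Complex.log u - Complex.log (((T / 2 : ℝ) : ℂ) * I)) - L ↗Λ w := by
    rw [hmodel]; ring
  rw [hsplit]
  have hn3 : ‖(1 / 2 : ℂ) * (digamma u - Complex.log u)‖ ≤ 2 / T := by
    rw [norm_mul, show ‖(1 / 2 : ℂ)‖ = 1 / 2 by simp]
    calc 1 / 2 * ‖digamma u - Complex.log u‖ ≤ 1 / 2 * (4 / T) := by gcongr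
      _ = 2 / T := by ring
  have hn4 : ‖(1 / 2 : ℂ) * (Complex.log u - Complex.log (((T / 2 : ℝ) : ℂ) * I))‖ ≤ v / (2 * T) := by
    rw [norm_mul, show ‖(1 / 2 : ℂ)‖ = 1 / 2 by simp]
    calc 1 / 2 * ‖Complex.log u - Complex.log (((T / 2 : ℝ) : ℂ) * I)‖ ≤ 1 / 2 * (v / T) := by
          gcongr
      _ = v / (2 * T) := by ring
  calc ‖1 / w + 1 / (w - 1) + 1 / 2 * (digamma u - Complex.log u) +
        1 / 2 * (Complex.log u - Complex.log (((T / 2 : ℝ) : ℂ) * I)) - L ↗Λ w‖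
      ≤ ‖1 / w‖ + ‖1 / (w - 1)‖ + ‖(1 / 2 : ℂ) * (digamma u - Complex.log u)‖ +
        ‖(1 / 2 : ℂ) * (Complex.log u - Complex.log (((T / 2 : ℝ) : ℂ) * I))‖ + ‖L ↗Λ w‖ := by
        refine (norm_sub_le _ _).trans ?_
        gcongr
        refine (norm_add_le _ _).trans ?_
        gcongr
        refine (norm_add_le _ _).trans ?_
        gcongr
        exact norm_add_le _ _
    _ ≤ 1 / T + 1 / T + 2 / T + v / (2 * T) + (π ^ 4 / 90 - 1) := by gcongr
    _ = (π ^ 4 / 90 - 1) + 4 / T + v / (2 * T) := by ring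

/-- Simplified form: for `T ≥ 5`, `5 ≤ v ≤ V`:
`‖ξ'/ξ(v + iT) − κ_T‖ ≤ 0.0824 + 4/T + V/(2T)`. [folklore] -/
theorem norm_logDeriv_riemannXi_sub_model_le' {T v V : ℝ} (hT : 5 ≤ T) (hv : 5 ≤ v) (hV : v ≤ V) :
    ‖logDeriv riemannXi ((v : ℂ) + T * I) - xiLogDerivModel T‖ ≤ 0.0824 + 4 / T + V / (2 * T) := by
  have h := norm_logDeriv_riemannXi_sub_model_le hT hv
  have hT0 : 0 < T := by linarith
  have h1 : v / (2 * T) ≤ V / (2 * T) := div_le_div_of_nonneg_right hV (by positivity)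
  linarith [pi_pow_four_div_ninety_sub_one_le]

/-! ## Integrating `ξ'/ξ` along a horizontal segment in `Re ≥ 1` -/

/-- **`ξ(w₀ + a) = ξ(w₀) · exp(∫_0^a ξ'/ξ(w₀ + x) dx)`** for `Re w₀ ≥ 1` and `a ≥ 0` (segment
integral of the logarithmic derivative; `ξ ≠ 0` on `Re ≥ 1`, and
`x ↦ ξ(w₀ + x) e^{-∫_0^x ξ'/ξ}` has zero derivative). [folklore] -/
theorem riemannXi_eq_mul_exp_integral_logDeriv {w₀ : ℂ} (hw₀ : 1 ≤ w₀.re) {a : ℝ} (ha : 0 ≤ a) :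
    riemannXi (w₀ + a) = riemannXi w₀ *
      Complex.exp (∫ x in (0:ℝ)..a, logDeriv riemannXi (w₀ + x)) := by
  set seg : ℝ → ℂ := fun x ↦ w₀ + (x : ℂ) with hseg
  have hne : ∀ x : ℝ, 0 ≤ x → riemannXi (seg x) ≠ 0 := fun x hx ↦
    riemannXi_ne_zero_of_one_le_re (by simp [hseg]; linarith)
  -- clamped integrand, continuous on all of `ℝ`
  set cl : ℝ → ℝ := fun σ ↦ max 0 σ with hcl
  have hcl0 : ∀ σ, 0 ≤ cl σ := fun σ ↦ le_max_left _ _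
  have hcl_id : ∀ σ, 0 ≤ σ → cl σ = σ := fun σ hσ ↦ max_eq_right hσ
  have hcl_cont : Continuous cl := by fun_prop
  set f : ℝ → ℂ := fun σ ↦ logDeriv riemannXi (seg (cl σ)) with hf
  have hf_cont : Continuous f := by
    have hsegc : Continuous fun σ ↦ seg (cl σ) := by simp only [hseg]; fun_prop
    exact continuousOn_logDeriv_riemannXi.comp_continuous hsegc fun σ ↦ hne _ (hcl0 σ)
  set P : ℝ → ℂ := fun τ ↦ ∫ σ in (0:ℝ)..τ, f σ with hP
  have hP_deriv : ∀ τ, HasDerivAt P (f τ) τ := fun τ ↦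
    intervalIntegral.integral_hasDerivAt_right (hf_cont.intervalIntegrable _ _)
      (hf_cont.stronglyMeasurableAtFilter _ _) hf_cont.continuousAt
  set G : ℝ → ℂ := fun τ ↦ riemannXi (seg τ) * Complex.exp (-P τ) with hG
  have hG_deriv : ∀ τ : ℝ, 0 ≤ τ → HasDerivAt G 0 τ := by
    intro τ hτ
    have hξ : HasDerivAt (fun τ : ℝ ↦ riemannXi (seg τ)) (deriv riemannXi (seg τ)) τ := by
      have hi : HasDerivAt (fun z : ℂ ↦ w₀ + z) 1 (τ : ℂ) := by
        simpa using (hasDerivAt_id (τ : ℂ)).const_add w₀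
      have h1 := (differentiable_riemannXi (seg τ)).hasDerivAt.comp (τ : ℂ) hi
      rw [mul_one] at h1
      exact h1.comp_ofReal
    have hE : HasDerivAt (fun τ : ℝ ↦ Complex.exp (-P τ)) (Complex.exp (-P τ) * -f τ) τ :=
      (hP_deriv τ).neg.cexp
    have hprod := hξ.mul hE
    have hd : deriv riemannXi (seg τ) = logDeriv riemannXi (seg τ) * riemannXi (seg τ) := by
      rw [logDeriv_apply, div_mul_cancel₀ _ (hne τ hτ)]
    have hfτ : f τ = logDeriv riemannXi (seg τ) := by simp only [hf, hcl_id τ hτ]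
    have hzero : deriv riemannXi (seg τ) * Complex.exp (-P τ) +
        riemannXi (seg τ) * (Complex.exp (-P τ) * -f τ) = 0 := by
      rw [hd, hfτ]; ring
    rw [hzero] at hprod
    exact hprod
  have hG_cont : ContinuousOn G (Icc 0 a) := fun τ hτ ↦
    (hG_deriv τ hτ.1).continuousAt.continuousWithinAt
  have hconst := constant_of_has_deriv_right_zero hG_cont
    (fun τ hτ ↦ (hG_deriv τ hτ.1).hasDerivWithinAt) a ⟨ha, le_rfl⟩
  -- unpack `G a = G 0`
  have hP0 : P 0 = 0 := by simp [hP]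
  have hseg0 : seg 0 = w₀ := by simp [hseg]
  have hsega : seg a = w₀ + a := by simp [hseg]
  have hPa : P a = ∫ x in (0:ℝ)..a, logDeriv riemannXi (w₀ + x) := by
    simp only [hP]
    refine intervalIntegral.integral_congr fun σ hσ ↦ ?_
    rw [Set.uIcc_of_le ha] at hσ
    simp only [hf, hseg, hcl_id σ hσ.1]
  simp only [hG, hseg0, hsega, hP0, neg_zero, Complex.exp_zero, mul_one] at hconst
  rw [← hPa, ← hconst, mul_assoc, ← Complex.exp_add, neg_add_cancel, Complex.exp_zero, mul_one]

/-- `ξ'/ξ` is continuous along horizontal rays in `Re ≥ 1`. [folklore] -/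
theorem continuous_logDeriv_riemannXi_horizontal {w₀ : ℂ} (hw₀ : 1 ≤ w₀.re) :
    ContinuousOn (fun x : ℝ ↦ logDeriv riemannXi (w₀ + x)) (Ici 0) := by
  refine continuousOn_logDeriv_riemannXi.comp (by fun_prop) fun x hx ↦ ?_
  exact riemannXi_ne_zero_of_one_le_re (by simp; linarith [mem_Ici.1 hx])

/-! ## Two-point control of `ξ` on the ray `Re w ≥ 5` at height `T` -/

/-- The error rate on the ray: `η_T = 0.0824 + 4/T` (prime sum plus Stirling error). [folklore] -/
def xiRayErr (T : ℝ) : ℝ := 0.0824 + 4 / T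

/-- `η_T ≥ 0` for `T > 0`. [folklore] -/
theorem xiRayErr_nonneg {T : ℝ} (hT : 0 < T) : 0 ≤ xiRayErr T := by
  rw [xiRayErr]; positivity

/-- `η_T ≤ 0.9` for `T ≥ 5` (crude). [folklore] -/
theorem xiRayErr_le {T : ℝ} (hT : 5 ≤ T) : xiRayErr T ≤ 0.9 := by
  rw [xiRayErr]
  have : 4 / T ≤ 4 / 5 := div_le_div_of_nonneg_left (by norm_num) (by norm_num) hT
  linarith

/-- **Two-point control along the ray** (integrated form of
`norm_logDeriv_riemannXi_sub_model_le`): for `T ≥ 5`, `v₀ ≥ 5`, `a ≥ 0` there is `ρ` with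
`ξ(v₀ + a + iT) = ξ(v₀ + iT) · exp(κ_T a + ρ)` and `‖ρ‖ ≤ a (η_T + (v₀ + a)/(2T))`.
[cite: Polymath2019, §9] -/
theorem riemannXi_horizontal_two_point {T v₀ a : ℝ} (hT : 5 ≤ T) (hv₀ : 5 ≤ v₀) (ha : 0 ≤ a) :
    ∃ ρ : ℂ, ‖ρ‖ ≤ a * (xiRayErr T + (v₀ + a) / (2 * T)) ∧
      riemannXi ((v₀ + a : ℝ) + T * I) =
        riemannXi ((v₀ : ℝ) + T * I) * Complex.exp (xiLogDerivModel T * a + ρ) := by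
  have hT0 : 0 < T := by linarith
  set w₀ : ℂ := (v₀ : ℂ) + T * I with hw₀
  have hw₀re : 1 ≤ w₀.re := by simp [hw₀]; linarith
  set Lf : ℝ → ℂ := fun x ↦ logDeriv riemannXi (w₀ + x) with hLf
  have hcont : ContinuousOn Lf (uIcc 0 a) := by
    rw [uIcc_of_le ha]
    exact (continuous_logDeriv_riemannXi_horizontal hw₀re).mono Icc_subset_Ici_self
  have hint : IntervalIntegrable Lf volume 0 a := hcont.intervalIntegrable
  have hkey := riemannXi_eq_mul_exp_integral_logDeriv hw₀re ha
  set ρ : ℂ := (∫ x in (0:ℝ)..a, Lf x) - xiLogDerivModel T * a with hρ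
  refine ⟨ρ, ?_, ?_⟩
  · -- `ρ = ∫_0^a (ξ'/ξ(w₀ + x) − κ_T) dx`
    have hρ' : ρ = ∫ x in (0:ℝ)..a, (Lf x - xiLogDerivModel T) := by
      rw [intervalIntegral.integral_sub hint (intervalIntegrable_const), hρ,
        intervalIntegral.integral_const]
      simp only [sub_zero, Complex.real_smul]
      ring
    rw [hρ']
    have hb : ∀ x ∈ Set.uIoc (0:ℝ) a, ‖Lf x - xiLogDerivModel T‖ ≤ xiRayErr T + (v₀ + a) / (2 * T) := by
      intro x hx
      rw [uIoc_of_le ha] at hx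
      have hx0 : 0 < x := hx.1
      have hxa : x ≤ a := hx.2
      have h := norm_logDeriv_riemannXi_sub_model_le' (v := v₀ + x) (V := v₀ + a) hT
        (by linarith) (by linarith)
      have e : ((v₀ + x : ℝ) : ℂ) + T * I = w₀ + x := by simp [hw₀]; ring
      rw [e] at h
      simpa [hLf, xiRayErr] using h
    calc ‖∫ x in (0:ℝ)..a, (Lf x - xiLogDerivModel T)‖
        ≤ (xiRayErr T + (v₀ + a) / (2 * T)) * |a - 0| := norm_integral_le_of_norm_le_const hb
      _ = a * (xiRayErr T + (v₀ + a) / (2 * T)) := by rw [sub_zero, abs_of_nonneg ha]; ring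
  · have e : ((v₀ + a : ℝ) : ℂ) + T * I = w₀ + a := by simp [hw₀]; ring
    rw [e, hkey]
    congr 2
    simp only [hρ, hLf]
    ring

/-- `‖exp(κ_T a + ρ)‖` lies between `e^{ℓa − ‖ρ‖}` and `e^{ℓa + ‖ρ‖}`, `ℓ = ½ log(T/2π)`. [folklore] -/
theorem norm_exp_model_mul_add {T a : ℝ} (ρ : ℂ) :
    ‖Complex.exp (xiLogDerivModel T * a + ρ)‖ = Real.exp (Real.log (T / (2 * π)) / 2 * a + ρ.re) := by
  rw [Complex.norm_exp]
  congr 1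
  simp [xiLogDerivModel]

/-- **Upper two-point bound for `|ξ|` along the ray**: for `T ≥ 5`, `v₀ ≥ 5`, `a ≥ 0`,
`‖ξ(v₀ + a + iT)‖ ≤ ‖ξ(v₀ + iT)‖ · exp(ℓ a + a(η_T + (v₀+a)/(2T)))`, `ℓ = ½ log(T/2π)`.
[cite: Polymath2019, §9] -/
theorem norm_riemannXi_horizontal_le {T v₀ a : ℝ} (hT : 5 ≤ T) (hv₀ : 5 ≤ v₀) (ha : 0 ≤ a) :
    ‖riemannXi ((v₀ + a : ℝ) + T * I)‖ ≤ ‖riemannXi ((v₀ : ℝ) + T * I)‖ *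
      Real.exp (Real.log (T / (2 * π)) / 2 * a + a * (xiRayErr T + (v₀ + a) / (2 * T))) := by
  obtain ⟨ρ, hρ, heq⟩ := riemannXi_horizontal_two_point hT hv₀ ha
  rw [heq, norm_mul, norm_exp_model_mul_add]
  gcongr
  exact (Complex.re_le_norm ρ).trans hρ

/-- **Lower two-point bound for `|ξ|` along the ray**: for `T ≥ 5`, `v₀ ≥ 5`, `a ≥ 0`,
`‖ξ(v₀ + iT)‖ · exp(ℓ a − a(η_T + (v₀+a)/(2T))) ≤ ‖ξ(v₀ + a + iT)‖`. [cite: Polymath2019, §9] -/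
theorem le_norm_riemannXi_horizontal {T v₀ a : ℝ} (hT : 5 ≤ T) (hv₀ : 5 ≤ v₀) (ha : 0 ≤ a) :
    ‖riemannXi ((v₀ : ℝ) + T * I)‖ *
      Real.exp (Real.log (T / (2 * π)) / 2 * a - a * (xiRayErr T + (v₀ + a) / (2 * T))) ≤
      ‖riemannXi ((v₀ + a : ℝ) + T * I)‖ := by
  obtain ⟨ρ, hρ, heq⟩ := riemannXi_horizontal_two_point hT hv₀ ha
  rw [heq, norm_mul, norm_exp_model_mul_add]
  gcongr
  have := (Complex.abs_re_le_norm ρ).trans hρ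
  linarith [neg_abs_le ρ.re]

/-- **The backward form**: for `T ≥ 5`, `v₀ ≥ 5`, `a ≥ 0` there is `ρ` with
`ξ(v₀ + iT) = ξ(v₀ + a + iT) · exp(−κ_T a + ρ)` and `‖ρ‖ ≤ a (η_T + (v₀ + a)/(2T))`. [folklore] -/
theorem riemannXi_horizontal_two_point' {T v₀ a : ℝ} (hT : 5 ≤ T) (hv₀ : 5 ≤ v₀) (ha : 0 ≤ a) :
    ∃ ρ : ℂ, ‖ρ‖ ≤ a * (xiRayErr T + (v₀ + a) / (2 * T)) ∧
      riemannXi ((v₀ : ℝ) + T * I) =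
        riemannXi ((v₀ + a : ℝ) + T * I) * Complex.exp (-(xiLogDerivModel T * a) + ρ) := by
  obtain ⟨ρ, hρ, heq⟩ := riemannXi_horizontal_two_point hT hv₀ ha
  refine ⟨-ρ, by rwa [norm_neg], ?_⟩
  rw [heq, mul_assoc, ← Complex.exp_add, show xiLogDerivModel T * a + ρ + (-(xiLogDerivModel T * a) + -ρ) = 0 by ring,
    Complex.exp_zero, mul_one]

end Literature.NumberTheory.LFunctions

end
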